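import Mathlib
import Literature.MathematicalPhysics.QuantumLattice.LatticeToriProofs

/-!
# A quadratic partition of unity on the discrete circle (support for stub `stub_windowModesLocalised`)
(line `block-away-the-sign`, crux `Summit.QuantumFields.QCD.Theses.SpectralDefectExtinction.ExtinctionBuildsQCD`,
item stmt-QuantumFields-18064)

Elementary real analysis and arithmetic on `ZMod L` (Mathlib plus the cyclic absolute value lemmas of
`Literature/MathematicalPhysics/QuantumLattice/LatticeToriProofs.lean`).  The circle `ZMod L` is cut into
`n = ⌊L/r⌋ ≥ 2` consecutive blocks, block `b < n - 1` being `[br, (b+1)r)` and the last block `[(n-1)r, L)`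
(length in `[r, 2r)`); on block `b` the angle `φ = (π/2)·(v − br)/len(b)` runs from `0` to `π/2`, and the
partition functions indexed by `j ∈ ZMod n` are `χ_j = cos φ` on block `j`, `sin φ` on block `j − 1`, `0`
elsewhere.  The block map, lengths, angle and partition functions are not introduced as definitions: the lemmas
are stated for functions `blk, blen, bang, chi` satisfying the defining equations (`hblk`, `hblen`, `hbang`,
`hchi`), and the export `stub_windowModesLocalisedAux2` is the resulting EXISTENCE statement:

`Σ_j χ_j(t)² = 1` (a QUADRATIC partition of unity, as IMS localisation needs); `χ_j(t) ≠ 0` only on blocks `j`,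
`j − 1`; `Σ_j (χ_j(t+1) − χ_j(t))² ≤ 8/r²` (from `|cos x − cos y| ≤ |x − y|`); points at cyclic distance `≤ 2` lie
in blocks at cyclic index distance `≤ 2`; a block has at most `2r` points.

Reference (prose): Cycon–Froese–Kirsch–Simon, *Schrödinger operators* (1987) §3.1 (IMS partitions of unity).
-/

noncomputable section

namespace Summit.QuantumFields.QCD.Cruxes.ExtinctionBuildsQCD.BlockAwayTheSign

open scoped BigOperators Classical
open Finset Literature.MathematicalPhysics.QuantumLattice

namespace WindowModes

section Blocks

variable {L r n : ℕ} {blk : ℕ → ℕ} {blen : ℕ → ℕ} {bang : ℕ → ℝ}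
  (hblk : ∀ v, blk v = min (v / r) (n - 1))
  (hblen : ∀ b, blen b = if b = n - 1 then L - (n - 1) * r else r)
  (hbang : ∀ v, bang v = Real.pi / 2 * (((v - blk v * r : ℕ) : ℝ) / (blen (blk v) : ℝ)))

include hblk in
/-- `blk v < n` (for `n ≥ 1`). -/
theorem blk_lt (hn : 1 ≤ n) (v : ℕ) : blk v < n := by
  rw [hblk]; omega

include hblk in
/-- `r · blk v ≤ v`. -/
theorem blk_mul_le (v : ℕ) : blk v * r ≤ v := by
  rw [hblk]; exact (Nat.mul_le_mul_right _ (min_le_left _ _)).trans (Nat.div_mul_le_self v r)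

include hblen in
/-- Every block has length at least `r` (given `n r ≤ L`). -/
theorem le_blen (hn : 1 ≤ n) (hnr : n * r ≤ L) (b : ℕ) : r ≤ blen b := by
  rw [hblen]
  split_ifs with hb
  · have h1 : (n - 1) * r = n * r - r := Nat.sub_one_mul n r
    have h2 : r ≤ n * r := Nat.le_mul_of_pos_left r hn
    omega
  · exact le_rfl

include hblen in
/-- Every block has length `< 2r` (given `L < (n+1) r`). -/
theorem blen_lt (hr : 0 < r) (hn : 1 ≤ n) (hL : L < (n + 1) * r) (b : ℕ) : blen b < 2 * r := by
  rw [hblen]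
  split_ifs with hb
  · have h1 : (n - 1) * r = n * r - r := Nat.sub_one_mul n r
    have h2 : r ≤ n * r := Nat.le_mul_of_pos_left r hn
    have h3 : (n + 1) * r = n * r + r := by ring
    omega
  · omega

include hblk hblen in
/-- `v < r · blk v + len(blk v)` for `v < L`. -/
theorem lt_blk_mul_add_blen (hr : 0 < r) (hn : 1 ≤ n) {v : ℕ} (hv : v < L) :
    v < blk v * r + blen (blk v) := by
  rw [hblen, hblk]
  rcases lt_or_ge (v / r) (n - 1) with h | h
  · rw [min_eq_left h.le, if_neg h.ne]
    exact Nat.lt_div_mul_add hr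
  · rw [min_eq_right h, if_pos rfl]
    have h1 : (n - 1) * r = n * r - r := Nat.sub_one_mul n r
    have h2 : r ≤ n * r := Nat.le_mul_of_pos_left r hn
    omega

include hblk in
/-- If `blk v ≠ n - 1` then `blk v = v / r < n - 1`. -/
theorem blk_eq_div_of_ne {v : ℕ} (h : blk v ≠ n - 1) : blk v = v / r ∧ v / r < n - 1 := by
  rw [hblk] at h ⊢
  rcases lt_or_ge (v / r) (n - 1) with h' | h'
  · exact ⟨min_eq_left h'.le, h'⟩
  · exact absurd (min_eq_right h') h

/-- The value of `t + 1` in `ZMod L`. -/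
theorem val_add_one [NeZero L] (t : ZMod L) :
    (t + 1).val = if t.val + 1 < L then t.val + 1 else 0 := by
  have h1 : t + 1 = ((t.val + 1 : ℕ) : ZMod L) := by
    push_cast; rw [ZMod.natCast_zmod_val]
  rw [h1, ZMod.val_natCast]
  split_ifs with h
  · exact Nat.mod_eq_of_lt h
  · have : t.val + 1 = L := by have := ZMod.val_lt t; omega
    rw [this, Nat.mod_self]

include hblk hblen hbang in
/-- **The step relation.**  Going from `t` to `t + 1` on `ZMod L` either stays in the same block and advances
the angle by `(π/2)/len`, or enters the next block (cyclically), the angle dropping from `π/2 − (π/2)/len`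
to `0`. -/
theorem step [NeZero L] (hr : 0 < r) (hn : 1 ≤ n) (hnr : n * r ≤ L) (t : ZMod L) :
    (blk (t + 1).val = blk t.val ∧
        bang (t + 1).val = bang t.val + Real.pi / 2 / blen (blk t.val)) ∨
      (((blk (t + 1).val : ℕ) : ZMod n) = ((blk t.val : ℕ) : ZMod n) + 1 ∧
        bang (t + 1).val = 0 ∧ bang t.val = Real.pi / 2 - Real.pi / 2 / blen (blk t.val)) := by
  set v := t.val with hv
  have hvL : v < L := ZMod.val_lt t
  have hlen0 : ∀ b, (0 : ℝ) < blen b := fun b => by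
    have := le_blen hblen hn hnr b; exact_mod_cast hr.trans_le this
  have hblkv := blk_mul_le hblk v
  have hvlt := lt_blk_mul_add_blen hblk hblen hr hn hvL
  rw [val_add_one t, ← hv]
  split_ifs with h1
  · -- no wrap-around
    rcases (show v + 1 ≤ blk v * r + blen (blk v) from hvlt).lt_or_eq with hint | hbdry
    · -- interior step
      left
      have hb : blk (v + 1) = blk v := by
        rw [hblk, hblk]
        by_cases hlast : v / r < n - 1
        · have hbv : blk v = v / r := by rw [hblk]; exact min_eq_left hlast.le
          rw [hbv, hblen, if_neg hlast.ne] at hint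
          have : (v + 1) / r = v / r :=
            Nat.div_eq_of_lt_le (by linarith [Nat.div_mul_le_self v r]) (by linarith)
          rw [this]
        · push Not at hlast
          rw [min_eq_right hlast, min_eq_right (hlast.trans (Nat.div_le_div_right (Nat.le_succ v)))]
      refine ⟨hb, ?_⟩
      rw [hbang, hbang, hb]
      have hsub : ((v + 1 - blk v * r : ℕ) : ℝ) = ((v - blk v * r : ℕ) : ℝ) + 1 := by
        rw [Nat.sub_add_comm hblkv]; push_cast; ring
      rw [hsub]
      field_simp
    · -- boundary step inside `{0, …, L-1}`
      right
      have hne : blk v ≠ n - 1 := by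
        intro heq
        rw [heq, hblen, if_pos rfl] at hbdry
        have h1' : (n - 1) * r = n * r - r := Nat.sub_one_mul n r
        have h2 : r ≤ n * r := Nat.le_mul_of_pos_left r hn
        omega
      obtain ⟨hbv, hlt⟩ := blk_eq_div_of_ne hblk hne
      have hlenv : blen (blk v) = r := by rw [hblen, if_neg hne]
      rw [hlenv] at hbdry ⊢
      rw [hbv] at hbdry
      have hdiv : (v + 1) / r = v / r + 1 := by
        rw [hbdry, show v / r * r + r = (v / r + 1) * r by ring, Nat.mul_div_cancel _ hr]
      have hb1 : blk (v + 1) = v / r + 1 := by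
        rw [hblk, hdiv]; exact min_eq_left (by omega)
      refine ⟨by rw [hb1, hbv]; push_cast; ring, ?_, ?_⟩
      · rw [hbang, hb1]
        have h0 : v + 1 - (v / r + 1) * r = 0 := by
          have : (v / r + 1) * r = v / r * r + r := by ring
          omega
        rw [h0]
        simp
      · rw [hbang, hlenv, hbv]
        have hsub : ((v - v / r * r : ℕ) : ℝ) = (r : ℝ) - 1 := by
          have : v - v / r * r = r - 1 := by omega
          rw [this, Nat.cast_sub hr]; simp
        rw [hsub]
        have hr0 : (r : ℝ) ≠ 0 := by exact_mod_cast hr.ne'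
        field_simp
  · -- wrap-around: `v = L - 1`, `t + 1 = 0`
    right
    have hvL' : v + 1 = L := by omega
    have h1' : (n - 1) * r = n * r - r := Nat.sub_one_mul n r
    have h2 : r ≤ n * r := Nat.le_mul_of_pos_left r hn
    have hbv : blk v = n - 1 := by
      rw [hblk]
      refine min_eq_right ((Nat.le_div_iff_mul_le hr).mpr ?_)
      omega
    have hb0 : blk 0 = 0 := by rw [hblk]; simp
    refine ⟨?_, ?_, ?_⟩
    · rw [hb0, hbv, Nat.cast_zero]
      have : ((n - 1 : ℕ) : ZMod n) + 1 = ((n - 1 + 1 : ℕ) : ZMod n) := by push_cast; ring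
      rw [this, Nat.sub_add_cancel hn, ZMod.natCast_self]
    · rw [hbang, hb0]; simp
    · rw [hbang, hbv, hblen, if_pos rfl]
      have hle : (n - 1) * r ≤ v := by omega
      have hsub : ((v - (n - 1) * r : ℕ) : ℝ) = ((L - (n - 1) * r : ℕ) : ℝ) - 1 := by
        rw [Nat.cast_sub hle, Nat.cast_sub (by omega : (n - 1) * r ≤ L)]
        have : (v : ℝ) = (L : ℝ) - 1 := by
          rw [← hvL']; push_cast; ring
        rw [this]; ring
      rw [hsub]
      have hl0 : ((L - (n - 1) * r : ℕ) : ℝ) ≠ 0 := by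
        have := hlen0 (n - 1); rw [hblen, if_pos rfl] at this; exact this.ne'
      field_simp

end Blocks

/-! ## The partition of unity -/

section Partition

variable {L r n : ℕ} {blk : ℕ → ℕ} {blen : ℕ → ℕ} {bang : ℕ → ℝ} {chi : ZMod n → ZMod L → ℝ}
  (hblk : ∀ v, blk v = min (v / r) (n - 1))
  (hblen : ∀ b, blen b = if b = n - 1 then L - (n - 1) * r else r)
  (hbang : ∀ v, bang v = Real.pi / 2 * (((v - blk v * r : ℕ) : ℝ) / (blen (blk v) : ℝ)))
  (hchi : ∀ j t, chi j t = if ((blk t.val : ℕ) : ZMod n) = j then Real.cos (bang t.val)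
    else if ((blk t.val : ℕ) : ZMod n) + 1 = j then Real.sin (bang t.val) else 0)

include hchi in
/-- **Quadratic partition of unity**: `Σ_j χ_j(t)² = 1`. -/
theorem sum_chi_sq [NeZero n] (hn : 2 ≤ n) (t : ZMod L) : ∑ j : ZMod n, chi j t ^ 2 = 1 := by
  set B : ZMod n := ((blk t.val : ℕ) : ZMod n) with hB
  have hne : B ≠ B + 1 := fun h => by
    haveI : Fact (1 < n) := ⟨hn⟩
    exact one_ne_zero (add_left_cancel (show B + 1 = B + 0 by rw [add_zero]; exact h.symm))
  rw [Fintype.sum_eq_add B (B + 1) hne]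
  · simp only [hchi, ← hB, if_true, if_neg hne, Real.cos_sq_add_sin_sq]
  · intro j hj
    simp only [hchi, ← hB, if_neg (Ne.symm hj.1), if_neg (Ne.symm hj.2)]
    ring

include hchi in
/-- `χ_j(t) ≠ 0` only if `t` lies in block `j` or in block `j − 1`. -/
theorem chi_ne_zero {j : ZMod n} {t : ZMod L} (h : chi j t ≠ 0) :
    ((blk t.val : ℕ) : ZMod n) = j ∨ ((blk t.val : ℕ) : ZMod n) + 1 = j := by
  rw [hchi] at h
  split_ifs at h with h1 h2
  · exact Or.inl h1
  · exact Or.inr h2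
  · exact absurd rfl h

include hblk hblen hbang hchi in
/-- **Lipschitz bound**: `Σ_j (χ_j(t+1) − χ_j(t))² ≤ 8 / r²`. -/
theorem sum_chi_step_sq_le [NeZero L] [NeZero n] (hr : 0 < r) (hn : 2 ≤ n) (hnr : n * r ≤ L)
    (t : ZMod L) :
    ∑ j : ZMod n, (chi j (t + 1) - chi j t) ^ 2 ≤ 8 / (r : ℝ) ^ 2 := by
  have hn1 : 1 ≤ n := by omega
  set B : ZMod n := ((blk t.val : ℕ) : ZMod n) with hB
  set B' : ZMod n := ((blk (t + 1).val : ℕ) : ZMod n) with hB'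
  set θ := bang t.val with hθ
  set θ' := bang (t + 1).val with hθ'
  set δ : ℝ := Real.pi / 2 / blen (blk t.val) with hδ
  have hne : B ≠ B + 1 := fun h => by
    haveI : Fact (1 < n) := ⟨hn⟩
    exact one_ne_zero (add_left_cancel (show B + 1 = B + 0 by rw [add_zero]; exact h.symm))
  have hr0 : (0 : ℝ) < r := by exact_mod_cast hr
  have hlen : (r : ℝ) ≤ blen (blk t.val) := by exact_mod_cast le_blen hblen hn1 hnr _
  have hlen0 : (0 : ℝ) < blen (blk t.val) := hr0.trans_le hlen
  -- `2 δ² ≤ 8 / r²`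
  have hδr : δ ≤ 2 / r := by
    rw [hδ, div_le_div_iff₀ hlen0 hr0]
    nlinarith [Real.pi_le_four, Real.pi_pos.le]
  have hδ0 : 0 ≤ δ := by rw [hδ]; positivity
  have hbound : 2 * δ ^ 2 ≤ 8 / (r : ℝ) ^ 2 := by
    have h1 : δ ^ 2 ≤ (2 / r) ^ 2 := pow_le_pow_left₀ hδ0 hδr 2
    have h2 : (2 / (r : ℝ)) ^ 2 = 4 / (r : ℝ) ^ 2 := by rw [div_pow]; norm_num
    have h3 : 8 / (r : ℝ) ^ 2 = 2 * (4 / (r : ℝ) ^ 2) := by ring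
    rw [h3]
    linarith
  refine le_trans ?_ hbound
  rcases step hblk hblen hbang hr hn1 hnr t with ⟨hb, hang⟩ | ⟨hb, hang', hang⟩
  · -- interior step: `B' = B`, `θ' = θ + δ`
    have hBB : B' = B := by rw [hB', hb]
    have hθθ : θ' = θ + δ := hang
    rw [Fintype.sum_eq_add B (B + 1) hne]
    · simp only [hchi, ← hB, ← hB', ← hθ, ← hθ', hBB, hθθ, if_true, if_neg hne]
      have h1 := Real.abs_cos_sub_cos_le (θ + δ) θ
      have h2 := Real.abs_sin_sub_sin_le (θ + δ) θ
      rw [add_sub_cancel_left, abs_of_nonneg hδ0] at h1 h2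
      have h1' := sq_le_sq' (abs_le.mp h1).1 (abs_le.mp h1).2
      have h2' := sq_le_sq' (abs_le.mp h2).1 (abs_le.mp h2).2
      linarith
    · intro j hj
      simp only [hchi, ← hB, ← hB', hBB, if_neg (Ne.symm hj.1), if_neg (Ne.symm hj.2)]
      ring
  · -- boundary step: `B' = B + 1`, `θ' = 0`, `θ = π/2 − δ`
    have hBB : B' = B + 1 := by rw [hB', hB, hb]
    have hθ0 : θ' = 0 := hang'
    have hθθ : θ = Real.pi / 2 - δ := hang
    have hne2 : B + 1 ≠ B := hne.symm
    rw [Fintype.sum_eq_add B (B + 1) hne]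
    · simp only [hchi, ← hB, ← hB', ← hθ, ← hθ', hBB, hθ0, hθθ, if_true, if_neg hne, if_neg hne2,
        Real.cos_zero, Real.sin_zero, Real.cos_pi_div_two_sub, Real.sin_pi_div_two_sub, ite_self]
      have hc := Real.one_sub_sq_div_two_le_cos (x := δ)
      nlinarith [Real.sin_sq_add_cos_sq δ]
    · intro j hj
      have hj3 : ¬ (B + 1 = j) := Ne.symm hj.2
      simp only [hchi, ← hB, ← hB', hBB, hθ0, ← hθ', if_neg (Ne.symm hj.1), if_neg hj3, Real.sin_zero,
        ite_self]
      ring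

include hblk hblen hbang in
/-- Along `k` steps the block index advances (cyclically) by some `m ≤ k`. -/
theorem blk_add_nat [NeZero L] (hr : 0 < r) (hn : 2 ≤ n) (hnr : n * r ≤ L) (t : ZMod L) (k : ℕ) :
    ∃ m : ℕ, m ≤ k ∧ ((blk (t + k).val : ℕ) : ZMod n) = ((blk t.val : ℕ) : ZMod n) + m := by
  induction k with
  | zero => exact ⟨0, le_rfl, by simp⟩
  | succ k ih =>
    obtain ⟨m, hm, hk⟩ := ih
    have hstep := step hblk hblen hbang hr (by omega) hnr (t + k)
    have heq : t + (k : ZMod L) + 1 = t + ((k + 1 : ℕ) : ZMod L) := by push_cast; ring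
    rw [heq] at hstep
    rcases hstep with ⟨h, -⟩ | ⟨h, -, -⟩
    · exact ⟨m, Nat.le_succ_of_le hm, by rw [h, hk]⟩
    · exact ⟨m + 1, Nat.succ_le_succ hm, by rw [h, hk]; push_cast; ring⟩

/-- The cyclic absolute value of the class of a natural number is at most that number. -/
theorem cycAbs_natCast_le (m : ℕ) : min (m : ZMod n).val (n - (m : ZMod n).val) ≤ m :=
  (min_le_left _ _).trans (by rw [ZMod.val_natCast]; exact Nat.mod_le m n)

include hblk hblen hbang in
/-- **Block indices are 1-Lipschitz up to rounding**: two points of `ZMod L` at cyclic distance `≤ 2` lie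
in blocks whose indices are at cyclic distance `≤ 2` in `ZMod n`. -/
theorem cycAbs_blk_sub_blk_le [NeZero L] (hr : 0 < r) (hn : 2 ≤ n) (hnr : n * r ≤ L) (s t : ZMod L)
    (h : min (s - t).val (L - (s - t).val) ≤ 2) :
    min (((blk s.val : ℕ) : ZMod n) - ((blk t.val : ℕ) : ZMod n)).val
      (n - (((blk s.val : ℕ) : ZMod n) - ((blk t.val : ℕ) : ZMod n)).val) ≤ 2 := by
  rcases le_total (s - t).val (L - (s - t).val) with hle | hle
  · rw [min_eq_left hle] at h
    obtain ⟨m, hm, hms⟩ := blk_add_nat hblk hblen hbang hr hn hnr t (s - t).val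
    have hs : t + (((s - t).val : ℕ) : ZMod L) = s := by rw [ZMod.natCast_zmod_val]; ring
    rw [hs] at hms
    rw [hms, add_sub_cancel_left]
    exact (cycAbs_natCast_le m).trans (hm.trans h)
  · rw [min_eq_right hle] at h
    set k : ℕ := L - (s - t).val with hk
    have hts : t = s + (k : ZMod L) := by
      have h1 : (((s - t).val : ℕ) : ZMod L) = s - t := ZMod.natCast_zmod_val _
      have h2 : (k : ZMod L) = ((L : ℕ) : ZMod L) - (((s - t).val : ℕ) : ZMod L) := by
        rw [hk, Nat.cast_sub (ZMod.val_le _)]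
      rw [h2, ZMod.natCast_self, h1]; ring
    obtain ⟨m, hm, hmt⟩ := blk_add_nat hblk hblen hbang hr hn hnr s k
    rw [← hts] at hmt
    rw [hmt, sub_add_cancel_left, cyclicAbs_neg]
    exact (cycAbs_natCast_le m).trans (hm.trans h)

include hblk hblen in
/-- **A block has at most `2r` points.** -/
theorem card_filter_blk_eq_le [NeZero L] (hr : 0 < r) (hn : 2 ≤ n) (hL : L < (n + 1) * r)
    (j : ZMod n) :
    (univ.filter fun t : ZMod L => ((blk t.val : ℕ) : ZMod n) = j).card ≤ 2 * r := by
  have hn1 : 1 ≤ n := by omega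
  have key : ∀ t : ZMod L, ((blk t.val : ℕ) : ZMod n) = j →
      j.val * r ≤ t.val ∧ t.val < j.val * r + 2 * r := by
    intro t ht
    have hb : blk t.val = j.val := by
      have := congrArg ZMod.val ht
      rwa [ZMod.val_natCast, Nat.mod_eq_of_lt (blk_lt hblk hn1 t.val)] at this
    refine ⟨?_, ?_⟩
    · rw [← hb]; exact blk_mul_le hblk t.val
    · have h1 := lt_blk_mul_add_blen hblk hblen hr hn1 (ZMod.val_lt t)
      have h2 := blen_lt hblen hr hn1 hL (blk t.val)
      rw [← hb]; omega
  calc (univ.filter fun t : ZMod L => ((blk t.val : ℕ) : ZMod n) = j).card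
      ≤ (Finset.Ico (j.val * r) (j.val * r + 2 * r)).card := by
        refine Finset.card_le_card_of_injOn ZMod.val (fun t ht => ?_)
          (fun a _ b _ hab => ZMod.val_injective L hab)
        rw [Finset.coe_filter] at ht
        rw [Finset.coe_Ico, Set.mem_Ico]
        exact key t ht.2
    _ = 2 * r := by simp

end Partition

/-! ## Export: the circle partition as an existence statement -/

/-- **Helper W3-Aux2 (`stub_windowModesLocalisedAux2`) — a quadratic partition of unity on the discrete
circle.**  For `0 < r`, `2 ≤ n`, `n r ≤ L < (n+1) r` there are a block map `β : ZMod L → ZMod n` and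
functions `χ_j : ZMod L → ℝ` (`j ∈ ZMod n`) with `Σ_j χ_j² = 1`, `χ_j(t) ≠ 0 ⇒ β t ∈ {j, j−1}`,
`Σ_j (χ_j(t+1) − χ_j(t))² ≤ 8/r²`, `β` moving by at most `2` (cyclically) between points at cyclic distance
`≤ 2`, and every block `{β = j}` of size `≤ 2r`. -/
theorem stub_windowModesLocalisedAux2 : ∀ (L r n : ℕ) [NeZero L] [NeZero n], 0 < r → 2 ≤ n → n * r ≤ L → L < (n + 1) * r → ∃ (β : ZMod L → ZMod n) (χ : ZMod n → ZMod L → ℝ), (∀ t, ∑ j, χ j t ^ 2 = 1) ∧ (∀ j t, χ j t ≠ 0 → β t = j ∨ β t + 1 = j) ∧ (∀ t, ∑ j, (χ j (t + 1) - χ j t) ^ 2 ≤ 8 / (r : ℝ) ^ 2) ∧ (∀ s t : ZMod L, min (s - t).val (L - (s - t).val) ≤ 2 → min (β s - β t).val (n - (β s - β t).val) ≤ 2) ∧ (∀ j, (Finset.univ.filter fun t => β t = j).card ≤ 2 * r) := by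
  intro L r n _ _ hr hn hnr hL
  let blk : ℕ → ℕ := fun v => min (v / r) (n - 1)
  let blen : ℕ → ℕ := fun b => if b = n - 1 then L - (n - 1) * r else r
  let bang : ℕ → ℝ := fun v => Real.pi / 2 * (((v - blk v * r : ℕ) : ℝ) / (blen (blk v) : ℝ))
  let chi : ZMod n → ZMod L → ℝ := fun j t => if ((blk t.val : ℕ) : ZMod n) = j then Real.cos (bang t.val)
    else if ((blk t.val : ℕ) : ZMod n) + 1 = j then Real.sin (bang t.val) else 0
  exact ⟨fun t => ((blk t.val : ℕ) : ZMod n), chi, sum_chi_sq (blk := blk) (bang := bang) (fun j t => rfl) hn,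
    fun j t h => chi_ne_zero (blk := blk) (bang := bang) (fun j t => rfl) h,
    sum_chi_step_sq_le (blk := blk) (blen := blen) (bang := bang) (fun v => rfl) (fun b => rfl)
      (fun v => rfl) (fun j t => rfl) hr hn hnr,
    cycAbs_blk_sub_blk_le (blk := blk) (blen := blen) (bang := bang) (fun v => rfl) (fun b => rfl)
      (fun v => rfl) hr hn hnr,
    card_filter_blk_eq_le (blk := blk) (blen := blen) (fun v => rfl) (fun b => rfl) hr hn hL⟩

end WindowModes

end Summit.QuantumFields.QCD.Cruxes.ExtinctionBuildsQCD.BlockAwayTheSign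

end
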